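import Summits.QuantumFields.YangMills.Theorems.BalabanUVNodesN15KingModelBoxResolvent
import HarnessLib

/-!
# BalabanUVNodes ∕ N15 — THE KING-MODEL RUNG (PART Ν-c, v1.1 doc-only erratum): TRANSPORT OF TORUS ESTIMATES TO THE BOX AT `A = 0` — EVERY IMAGE IS AT LEAST AS FAR AS
# THE DIRECT TERM IN EVERY COORDINATE, SO ANY COORDINATEWISE-MONOTONE TORUS BOUND HOLDS ON `Ω` WITH CONSTANT `× 2^{d+1}`; THE TORUS–BOX TWIN IN THE BULK
# `0 ≤ (c(−Δ_free)+m²)⁻¹(s,t) − B⁻¹_{T(2n)}(s,t) ≤ (2^{d+1} − 1)·C·e^{−δ(2r+1)}`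
# (Track A, DAG node N15 = NE2; FAN-OUT v1.1 §N15 s3 «KING-MODEL RUNG» — its named alternative currency «torus-vs-box twin»; count-neutral)

HONEST FRAMING.  Count-neutral (cell `pub-ymgap`, seat `pub-ymgap-dag-n15-e` g39; `--supports stmt-QuantumFields-27366 --as helper` = K3⁸).
TEMPLATE LITERATURE: C. King, Commun. Math. Phys. **102** (1986) 649–677 [King1986] §4 p.670: the Ω-propagators are multiple-reflection sums ([Ba 4] =
[Balaban1983RegularityDecay] (2.42)) of the operator with free boundary conditions, «so it is sufficient to prove Propositions 3.8 and 3.9 for the operator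
with free boundary conditions» — estimates for one kernel transfer to the image sum.

ATTRIBUTION ∕ ERRATUM (v1.1, doc-only; ref-I READ-925 LOCATED-1 (quote), adopted).  King's p.670 text (§4, l.8–13) is: «By using multiple reflection representations,
the propagators G^η_k and G^η_k(Ω) can be written in terms of the operator defined by (2.13) with free boundary conditions (and A = 0, of course), as long
as Ω is a rectangular parallelepiped which is a union of blocks of L^k sites. Such representations are given explicitly in [Ba 4], so it is sufficient to
prove Propositions 3.8 and 3.9 for the operator with free boundary conditions» — i.e. King, following [Ba 4] = [Balaban1983RegularityDecay] (2.42) p.584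
(«We represent G_j(□) with the help of the propagator G_j with free boundary conditions on ξZ^d using the multiple reflection method»), writes the
Ω-propagators as image sums of the operator on the INFINITE lattice and proves his estimates for that operator.  Two sentences typeset as King quotations
in v1.0 of parts Ν-c ∕ Ν-d ∕ Ν-f — «…prove estimates on a lattice with periodic boundary conditions, and then carry over the results to Ω» and «All the
operators we use on Ω can be defined in this way, by restricting the corresponding operators on the torus to symmetric functions» — are NOT in
[King1986]: they were this author's paraphrases of the method, wrongly set in guillemets, and are WITHDRAWN as quotations (likewise v1.0's phrase «every
estimate is proved on the torus and transported to Ω» in parts Ν-a∕a′∕b: King proves the estimates for the free-boundary operator on ηℤ^d; the torus is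
this lineage's model of it).  What PART Ν formalises is the PERIODIZED, FINITE form of [Ba 4]'s image series — the `2^{d+1}` images in the TORUS of doubled
periods ([Ba 4]'s image group `Bool^{d+1} × ℤ^{d+1}` modulo the period lattice) — a device of these files (the classical method of images), chosen because
the tree carries King's operators on tori (`King1986.Torus.lapF`, `effLaplacian`); the box boundary condition so represented is the Neumann («free»)
condition of [Ba 4]'s `G_j(□)` ∕ [Balaban1984PropagatorsII] (2.37).  Every theorem of v1.0 is unchanged; only prose and locators are corrected.  Over parts Ν-a∕Ν-a′
(`(c(−Δ_free)+m²)⁻¹(s,t) = Σ_S B⁻¹_{T(2n)}(dblBox s, σ_S dblBox t)`, `boxOp_inv_apply`) THIS FILE makes that transfer a theorem for King's `A = 0`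
covariance, run from the TORUS of doubled periods (the periodized form of [Ba 4]'s image series): (§1) on the doubled torus the direct term does not wrap (`circAbs_{2n_μ}(s_μ − t_μ) = |s_μ − t_μ|`, since `|s_μ − t_μ| < n_μ`), a reflected
coordinate sits at circular distance `min(s_μ+t_μ+1, 2n_μ−1−s_μ−t_μ) ≥ |s_μ − t_μ|`, and at distance `≥ 2r+1` when both points are `≥ r` away from the
`μ`-faces; (§2) ★★ **`kingBoxGreen_le_of_coordProfile`**: hence EVERY bound `B⁻¹_{T(2n)}(w,w′) ≤ Φ((circAbs(w_μ−w′_μ))_μ)` with `Φ` antitone in the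
vector of coordinate distances holds for the box covariance at the box displacement `(|s_μ−t_μ|)_μ`, with the constant multiplied by the number `2^{d+1}`
of images; (§3) in King's printed shape (`C·e^{−δ·dist}` in the sup-distance `tdistT` of the tree's `King1986.UniformDecay`): `tdistT` is monotone in the
coordinate distances, so ★★ **`kingBoxGreen_le_exp_of_torusDecay`** (`G^{Ω}(s,t) ≤ 2^{d+1}·C·e^{−δ·tdistT(dblBox s, dblBox t)}`, same rate `δ`), and
★★★ **`kingBoxGreen_sub_direct_le_of_bulk`** — THE TORUS–BOX TWIN IN ALL `d+1` DIRECTIONS: for `s, t` at distance `≥ r` from every face of `Ω`,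
`0 ≤ G^{Ω}(s,t) − B⁻¹_{T(2n)}(dblBox s, dblBox t) ≤ (2^{d+1}−1)·C·e^{−δ(2r+1)}`: free boundary conditions are invisible in the bulk, at the rate of
the torus bound (the `d = 1` factor is part Ϲ-g′ `pathGreen_sub_line_le`).
NOT Bałaban's covariant `G(Ω)`; NOT a node discharge (N15 is booked through n15-a's knit, untouched); NO torus decay estimate is PROVED here — the
torus bound is the displayed hypothesis `hB` (the tree's uniform estimates for King's kernels, `King1986.PropagatorDecayUniform` ∕ the rung's
`…FullPropagator*Decay`, are stated on King's tori `Tor (fine L^k M)`; feeding them in is bookkeeping on the periods, not done here); nothing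
continuum-YM ∕ `ℝ⁴` ∕ OS axioms ∕ Clay.  0 `sorry`, 0 `def`.  PRIOR TREE ART as named in part Ν-a (AllWindowsColdBox's massless signed image sum and
its `…BoxKernelWallDecay`-type estimates for THAT kernel; dag-n15-a's `Sym∘G∘χ°`); objects here are King's.

WHAT THIS FILE PROVES (kernel).  §1 ★ `circAbs_dblBox_sub_dblBox`, `circAbs_dblBox_sub_image_of_mem`, ★ `abs_sub_le_circAbs_image`, ★ `circAbs_image_ge_of_bulk`.
§2 ★★ **`kingBoxGreen_le_of_coordProfile`**, `boxOp_inv_le_of_coordProfile`.  §3 `tdistT_mono_of_coord`, ★ `tdistT_dblBox_le_image`, `abs_sub_le_tdistT_dblBox`,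
★★ **`kingBoxGreen_le_exp_of_torusDecay`**, ★ `tdistT_image_ge_of_bulk`, ★★★ **`kingBoxGreen_sub_direct_le_of_bulk`**, `kingBoxGreen_sub_direct_nonneg`.

HONEST SCOPE.  Any `d`, any sides `n_μ ≥ 1`; `c, m²` arbitrary in §1–§2 (the profile hypothesis carries whatever is needed), `c ≥ 0`, `m² > 0` where the
inverse is named; `C, δ ≥ 0`.  King's `A = 0` scalar model; N15 untouched; counts unmoved.  Locators: [King1986] §4 p.670 (l.8–13), (2.13) p.653, (4.4) p.670 (symbol),
Prop. 3.7 p.663 with the decay shape at (3.63)–(3.65) (ref-I NIT: not (3.60)); [Balaban1983RegularityDecay] (2.42) p.584; [Balaban1984PropagatorsII] (2.37) p.229 (SHAPE).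
-/

noncomputable section

open scoped BigOperators symmDiff
open Finset Matrix

namespace Summit.QuantumFields.YangMills.BalabanUVNodes.N15KingModelRung.TorusSpectral

open Literature.MathematicalPhysics.QuantumFieldTheory.Balaban1983to89.B5Prop11Plancherel (Tor unitVec)
open Literature.MathematicalPhysics.QuantumFieldTheory.Balaban1983to89.B4TorusKernel.MultiPeriod (circAbs circAbs_nonneg circAbs_add_mul
  circAbs_of_centred circAbs_le_abs)
open Literature.MathematicalPhysics.QuantumFieldTheory.Balaban1983to89.B4Sect5Torus (tdist ccoord)
open Literature.MathematicalPhysics.QuantumFieldTheory.King1986.Torus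
open Summit.QuantumFields.YangMills.BalabanUVNodes.N15KingModelRung.ProperTime (lapF_inv_nonneg lapF_inv_pos isUnit_lapF)

variable {d : ℕ}

/-! ## §1 Every image is at least as far as the direct term, in every coordinate -/

section Coordinates

variable (n : Fin (d + 1) → ℕ) [hn : ∀ μ, NeZero (n μ)]

/-- ★ THE DIRECT TERM DOES NOT WRAP: on the doubled torus the circular coordinate distance of two box points is the box distance `|s_μ − t_μ|`
(`|s_μ − t_μ| ≤ n_μ − 1 <` half the period). [cite: King1986, §4 p.670] -/
theorem circAbs_dblBox_sub_dblBox (s t : KingBox n) (μ : Fin (d + 1)) :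
    circAbs (dblPer n μ) (((dblBox n s μ).val : ℤ) - ((dblBox n t μ).val : ℤ)) = |((s μ).val : ℤ) - ((t μ).val : ℤ)| := by
  rw [val_dblBox, val_dblBox]
  have hs := (s μ).isLt
  have ht := (t μ).isLt
  refine circAbs_of_centred (by simp only [dblPer]; have := NeZero.pos (n μ); omega) ?_
  simp only [dblPer]
  push_cast
  rcases le_total (((s μ).val : ℤ)) ((t μ).val : ℤ) with h | h
  · rw [abs_of_nonpos (by linarith)]; omega
  · rw [abs_of_nonneg (by linarith)]; omega

/-- In a REFLECTED direction the image coordinate distance is `min(s_μ + t_μ + 1, 2n_μ − 1 − s_μ − t_μ)`. [cite: King1986, §4 p.670] -/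
theorem circAbs_dblBox_sub_image_of_mem {S : Finset (Fin (d + 1))} {μ : Fin (d + 1)} (hμ : μ ∈ S) (s t : KingBox n) :
    circAbs (dblPer n μ) (((dblBox n s μ).val : ℤ) - ((torReflS (dblPer n) S (dblBox n t) μ).val : ℤ))
      = min (((s μ).val : ℤ) + (t μ).val + 1) (2 * (n μ : ℤ) - 1 - (s μ).val - (t μ).val) := by
  rw [val_dblBox]
  have hv : (torReflS (dblPer n) S (dblBox n t) μ).val = 2 * n μ - 1 - (t μ).val := by
    simp only [torReflS, hμ, if_true]; exact val_mirror_dblBox n t μ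
  rw [hv]
  have hs := (s μ).isLt
  have ht := (t μ).isLt
  have hper : ((s μ).val : ℤ) - ((2 * n μ - 1 - (t μ).val : ℕ) : ℤ)
      = (((s μ).val : ℤ) + (t μ).val + 1) + ((dblPer n μ : ℕ) : ℤ) * (-1) := by
    simp only [dblPer]; push_cast; omega
  rw [hper, circAbs_add_mul]
  unfold circAbs
  have h0 : (0 : ℤ) ≤ ((s μ).val : ℤ) + (t μ).val + 1 := by positivity
  have h1 : ((s μ).val : ℤ) + (t μ).val + 1 < ((dblPer n μ : ℕ) : ℤ) := by simp only [dblPer]; push_cast; omega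
  rw [Int.emod_eq_of_lt h0 h1]
  simp only [dblPer]; push_cast; ring_nf

/-- ★ **EVERY IMAGE IS AT LEAST AS FAR AS THE DIRECT TERM, IN EVERY COORDINATE**: `|s_μ − t_μ| ≤ circAbs_{2n_μ}((dblBox s)_μ − (σ_S dblBox t)_μ)` for every
`S ⊆ {0,…,d}` (equality for `μ ∉ S`). [cite: King1986, §4 p.670] -/
theorem abs_sub_le_circAbs_image (S : Finset (Fin (d + 1))) (s t : KingBox n) (μ : Fin (d + 1)) :
    |((s μ).val : ℤ) - ((t μ).val : ℤ)| ≤ circAbs (dblPer n μ) (((dblBox n s μ).val : ℤ) - ((torReflS (dblPer n) S (dblBox n t) μ).val : ℤ)) := by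
  by_cases hμ : μ ∈ S
  · rw [circAbs_dblBox_sub_image_of_mem n hμ]
    have hs := (s μ).isLt
    have ht := (t μ).isLt
    rw [abs_le]
    constructor
    · rw [neg_le, le_min_iff]; constructor <;> omega
    · rw [le_min_iff]; constructor <;> omega
  · have hv : torReflS (dblPer n) S (dblBox n t) μ = dblBox n t μ := by simp only [torReflS, hμ, if_false]
    rw [hv, circAbs_dblBox_sub_dblBox]

/-- ★ **PROPER IMAGES OF BULK POINTS ARE FAR**: if `s` and `t` are at distance `≥ r` from both `μ`-faces of the box and `μ ∈ S`, then the `μ`-coordinate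
distance of the image `σ_S(dblBox t)` from `dblBox s` is `≥ 2r + 1`. [cite: King1986, §4 p.670] -/
theorem circAbs_image_ge_of_bulk {S : Finset (Fin (d + 1))} {μ : Fin (d + 1)} (hμ : μ ∈ S) (s t : KingBox n) {r : ℕ}
    (hs : r ≤ (s μ).val) (ht : r ≤ (t μ).val) (hs' : (s μ).val + r < n μ) (ht' : (t μ).val + r < n μ) :
    (2 * r + 1 : ℤ) ≤ circAbs (dblPer n μ) (((dblBox n s μ).val : ℤ) - ((torReflS (dblPer n) S (dblBox n t) μ).val : ℤ)) := by
  rw [circAbs_dblBox_sub_image_of_mem n hμ, le_min_iff]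
  constructor <;> omega

end Coordinates

/-! ## §2 Transport of coordinatewise-monotone torus bounds to the box (King's use of the representation) -/

section Transport

variable (n : Fin (d + 1) → ℕ) [hn : ∀ μ, NeZero (n μ)]

/-- ★★ **KING's TRANSPORT OF TORUS ESTIMATES TO THE BOX, AT `A = 0`.**  Let `Φ` be a profile on coordinate-distance vectors, antitone for the product
order, bounding King's torus covariance of the doubled torus: `B⁻¹_{T(2n)}(w,w′) ≤ Φ((circAbs_{2n_μ}(w_μ − w′_μ))_μ)`.  Then the free-boundary box covariance
obeys the SAME bound at the box displacement, with the constant multiplied by the number of images: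
`(c(−Δ_free)+m²)⁻¹(s,t) ≤ 2^{d+1}·Φ((|s_μ − t_μ|)_μ)` — the transfer «it is sufficient to prove [the estimates] for the operator with free boundary
conditions» (King p.670, after [Ba 4] (2.42)), in its doubled-torus form. [cite: King1986, §4 p.670; Balaban1983RegularityDecay, (2.42) p.584] -/
theorem kingBoxGreen_le_of_coordProfile {c m2 : ℝ} (Φ : (Fin (d + 1) → ℤ) → ℝ) (hΦ : Antitone Φ)
    (hB : ∀ w w' : Tor (dblPer n), (lapF (dblPer n) c m2)⁻¹ w w' ≤ Φ (fun μ => circAbs (dblPer n μ) (((w μ).val : ℤ) - ((w' μ).val : ℤ))))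
    (s t : KingBox n) :
    kingBoxGreen n c m2 s t ≤ 2 ^ (d + 1) * Φ (fun μ => |((s μ).val : ℤ) - ((t μ).val : ℤ)|) := by
  unfold kingBoxGreen
  have hterm : ∀ S : Finset (Fin (d + 1)),
      (lapF (dblPer n) c m2)⁻¹ (dblBox n s) (torReflS (dblPer n) S (dblBox n t)) ≤ Φ (fun μ => |((s μ).val : ℤ) - ((t μ).val : ℤ)|) := by
    intro S
    refine le_trans (hB _ _) (hΦ ?_)
    intro μ
    exact abs_sub_le_circAbs_image n S s t μ
  calc ∑ S : Finset (Fin (d + 1)), (lapF (dblPer n) c m2)⁻¹ (dblBox n s) (torReflS (dblPer n) S (dblBox n t))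
      ≤ ∑ _S : Finset (Fin (d + 1)), Φ (fun μ => |((s μ).val : ℤ) - ((t μ).val : ℤ)|) := Finset.sum_le_sum fun S _ => hterm S
    _ = 2 ^ (d + 1) * Φ (fun μ => |((s μ).val : ℤ) - ((t μ).val : ℤ)|) := by
        rw [Finset.sum_const, Finset.card_univ, Fintype.card_finset, Fintype.card_fin, nsmul_eq_mul]
        push_cast; ring

/-- ★ The box covariance with its inverse: `(c(−Δ_free)+m²)⁻¹(s,t) ≤ 2^{d+1}Φ(|s−t|)` (`c ≥ 0`, `m² > 0`). [cite: King1986, §4 p.670] -/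
theorem boxOp_inv_le_of_coordProfile {c m2 : ℝ} (hc : 0 ≤ c) (hm : 0 < m2) (Φ : (Fin (d + 1) → ℤ) → ℝ) (hΦ : Antitone Φ)
    (hB : ∀ w w' : Tor (dblPer n), (lapF (dblPer n) c m2)⁻¹ w w' ≤ Φ (fun μ => circAbs (dblPer n μ) (((w μ).val : ℤ) - ((w' μ).val : ℤ))))
    (s t : KingBox n) :
    (boxOp n c m2)⁻¹ s t ≤ 2 ^ (d + 1) * Φ (fun μ => |((s μ).val : ℤ) - ((t μ).val : ℤ)|) := by
  rw [boxOp_inv_eq_kingBoxGreen n hc hm]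
  exact kingBoxGreen_le_of_coordProfile n Φ hΦ hB s t

end Transport

/-! ## §3 The sup-distance form: King's `C e^{−δ·dist}` shape, and the torus–box twin in the bulk -/

section SupDistance

variable (n : Fin (d + 1) → ℕ) [hn : ∀ μ, NeZero (n μ)]

/-- `tdistT` is monotone in the vector of circular coordinate distances. [folklore] -/
theorem tdistT_mono_of_coord (K : Fin (d + 1) → ℕ) [∀ μ, NeZero (K μ)] (x y x' y' : Tor K)
    (h : ∀ μ, circAbs (K μ) (((x μ).val : ℤ) - ((y μ).val : ℤ)) ≤ circAbs (K μ) (((x' μ).val : ℤ) - ((y' μ).val : ℤ))) :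
    tdistT K x y ≤ tdistT K x' y' := by
  unfold tdistT tdist
  have hs : Finset.univ.sup (ccoord K (toSite K x) (toSite K y)) ≤ Finset.univ.sup (ccoord K (toSite K x') (toSite K y')) := by
    refine Finset.sup_mono_fun fun μ _ => ?_
    unfold ccoord
    exact Int.toNat_le_toNat (h μ)
  exact_mod_cast hs

/-- ★ **THE BOX DISTANCE IS THE TORUS DISTANCE OF THE DIRECT IMAGES, AND EVERY PROPER IMAGE IS FARTHER**:
`tdistT_{T(2n)}(dblBox s, dblBox t) ≤ tdistT_{T(2n)}(dblBox s, σ_S dblBox t)` for every `S`. [cite: King1986, §4 p.670] -/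
theorem tdistT_dblBox_le_image (S : Finset (Fin (d + 1))) (s t : KingBox n) :
    tdistT (dblPer n) (dblBox n s) (dblBox n t) ≤ tdistT (dblPer n) (dblBox n s) (torReflS (dblPer n) S (dblBox n t)) := by
  refine tdistT_mono_of_coord (dblPer n) _ _ _ _ fun μ => ?_
  rw [circAbs_dblBox_sub_dblBox]
  exact abs_sub_le_circAbs_image n S s t μ

/-- The box sup-distance in coordinates: `tdistT_{T(2n)}(dblBox s, dblBox t) ≥ |s_μ − t_μ|` for every `μ` (no wrap-around). [folklore] -/
theorem abs_sub_le_tdistT_dblBox (s t : KingBox n) (μ : Fin (d + 1)) :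
    ((|((s μ).val : ℤ) - ((t μ).val : ℤ)| : ℤ) : ℝ) ≤ tdistT (dblPer n) (dblBox n s) (dblBox n t) := by
  have h := circAbs_le_tdistT (dblPer n) (dblBox n s) (dblBox n t) μ
  rw [circAbs_dblBox_sub_dblBox] at h
  exact h

/-- ★★ **KING's SHAPE**: a torus decay bound `B⁻¹_{T(2n)}(w,w′) ≤ C·e^{−δ·tdistT(w,w′)}` (`C, δ ≥ 0`) transports to the free-boundary box covariance as
`(c(−Δ_free)+m²)⁻¹(s,t) ≤ 2^{d+1}·C·e^{−δ·tdistT(dblBox s, dblBox t)}` — the same rate `δ` in the box sup-distance, constant `× 2^{d+1}`.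
[cite: King1986, §4 p.670, Prop. 3.7 (3.63)–(3.65) p.663 (the shape `e^{−δ|x−y|}` of the covariance bounds)] -/
theorem kingBoxGreen_le_exp_of_torusDecay {c m2 C δ : ℝ} (hC : 0 ≤ C) (hδ : 0 ≤ δ)
    (hB : ∀ w w' : Tor (dblPer n), (lapF (dblPer n) c m2)⁻¹ w w' ≤ C * Real.exp (-(δ * tdistT (dblPer n) w w'))) (s t : KingBox n) :
    kingBoxGreen n c m2 s t ≤ 2 ^ (d + 1) * (C * Real.exp (-(δ * tdistT (dblPer n) (dblBox n s) (dblBox n t)))) := by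
  unfold kingBoxGreen
  have hterm : ∀ S : Finset (Fin (d + 1)), (lapF (dblPer n) c m2)⁻¹ (dblBox n s) (torReflS (dblPer n) S (dblBox n t))
      ≤ C * Real.exp (-(δ * tdistT (dblPer n) (dblBox n s) (dblBox n t))) := by
    intro S
    refine le_trans (hB _ _) (mul_le_mul_of_nonneg_left ?_ hC)
    rw [Real.exp_le_exp, neg_le_neg_iff]
    exact mul_le_mul_of_nonneg_left (tdistT_dblBox_le_image n S s t) hδ
  calc ∑ S : Finset (Fin (d + 1)), (lapF (dblPer n) c m2)⁻¹ (dblBox n s) (torReflS (dblPer n) S (dblBox n t))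
      ≤ ∑ _S : Finset (Fin (d + 1)), C * Real.exp (-(δ * tdistT (dblPer n) (dblBox n s) (dblBox n t))) :=
        Finset.sum_le_sum fun S _ => hterm S
    _ = 2 ^ (d + 1) * (C * Real.exp (-(δ * tdistT (dblPer n) (dblBox n s) (dblBox n t)))) := by
        rw [Finset.sum_const, Finset.card_univ, Fintype.card_finset, Fintype.card_fin, nsmul_eq_mul]
        push_cast; ring

/-- ★ A PROPER image of a bulk pair is far in the sup-distance: if `s, t` are at distance `≥ r` from every face of `Ω` and `S ≠ ∅`, then
`tdistT_{T(2n)}(dblBox s, σ_S dblBox t) ≥ 2r + 1`. [cite: King1986, §4 p.670] -/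
theorem tdistT_image_ge_of_bulk {S : Finset (Fin (d + 1))} (hS : S.Nonempty) (s t : KingBox n) {r : ℕ}
    (hbulk : ∀ μ, r ≤ (s μ).val ∧ r ≤ (t μ).val ∧ (s μ).val + r < n μ ∧ (t μ).val + r < n μ) :
    (2 * r + 1 : ℝ) ≤ tdistT (dblPer n) (dblBox n s) (torReflS (dblPer n) S (dblBox n t)) := by
  obtain ⟨μ, hμ⟩ := hS
  obtain ⟨h1, h2, h3, h4⟩ := hbulk μ
  have hc := circAbs_image_ge_of_bulk n hμ s t h1 h2 h3 h4
  have hle := circAbs_le_tdistT (dblPer n) (dblBox n s) (torReflS (dblPer n) S (dblBox n t)) μ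
  have hc' : ((2 * r + 1 : ℤ) : ℝ) ≤ (circAbs (dblPer n μ) (((dblBox n s μ).val : ℤ) - ((torReflS (dblPer n) S (dblBox n t) μ).val : ℤ)) : ℝ) := by
    exact_mod_cast hc
  push_cast at hc'
  linarith

/-- ★★★ **THE TORUS–BOX TWIN IN THE BULK (all `d+1` directions)**: under a torus decay bound `B⁻¹_{T(2n)}(w,w′) ≤ C·e^{−δ·tdistT(w,w′)}`, for `s, t` at
distance `≥ r` from every face of `Ω`, the free-boundary box covariance and King's torus covariance of the doubled torus agree up to the `2^{d+1} − 1`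
proper images, each exponentially small in the distance to the boundary:
`0 ≤ (c(−Δ_free)+m²)⁻¹(s,t) − B⁻¹_{T(2n)}(dblBox s, dblBox t) ≤ (2^{d+1} − 1)·C·e^{−δ(2r+1)}` — free boundary conditions are invisible in the bulk at the
rate of the torus mass gap (the `d = 1` factor is part Ϲ-g′ `pathGreen_sub_line_le`). [cite: King1986, §4 p.670, Prop. 3.7 (3.63)–(3.65) p.663] -/
theorem kingBoxGreen_sub_direct_le_of_bulk {c m2 C δ : ℝ} (hC : 0 ≤ C) (hδ : 0 ≤ δ)
    (hB : ∀ w w' : Tor (dblPer n), (lapF (dblPer n) c m2)⁻¹ w w' ≤ C * Real.exp (-(δ * tdistT (dblPer n) w w'))) (s t : KingBox n) {r : ℕ}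
    (hbulk : ∀ μ, r ≤ (s μ).val ∧ r ≤ (t μ).val ∧ (s μ).val + r < n μ ∧ (t μ).val + r < n μ) :
    kingBoxGreen n c m2 s t - (lapF (dblPer n) c m2)⁻¹ (dblBox n s) (dblBox n t) ≤ (2 ^ (d + 1) - 1) * (C * Real.exp (-(δ * (2 * r + 1)))) := by
  unfold kingBoxGreen
  rw [← Finset.add_sum_erase _ _ (Finset.mem_univ (∅ : Finset (Fin (d + 1)))), torReflS_empty, add_sub_cancel_left]
  have hterm : ∀ S ∈ Finset.univ.erase (∅ : Finset (Fin (d + 1))),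
      (lapF (dblPer n) c m2)⁻¹ (dblBox n s) (torReflS (dblPer n) S (dblBox n t)) ≤ C * Real.exp (-(δ * (2 * r + 1))) := by
    intro S hS
    have hne : S.Nonempty := Finset.nonempty_iff_ne_empty.mpr (Finset.ne_of_mem_erase hS)
    refine le_trans (hB _ _) (mul_le_mul_of_nonneg_left ?_ hC)
    rw [Real.exp_le_exp, neg_le_neg_iff]
    exact mul_le_mul_of_nonneg_left (tdistT_image_ge_of_bulk n hne s t hbulk) hδ
  calc ∑ S ∈ Finset.univ.erase (∅ : Finset (Fin (d + 1))), (lapF (dblPer n) c m2)⁻¹ (dblBox n s) (torReflS (dblPer n) S (dblBox n t))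
      ≤ ∑ _S ∈ Finset.univ.erase (∅ : Finset (Fin (d + 1))), C * Real.exp (-(δ * (2 * r + 1))) := Finset.sum_le_sum hterm
    _ = (2 ^ (d + 1) - 1) * (C * Real.exp (-(δ * (2 * r + 1)))) := by
        rw [Finset.sum_const, Finset.card_erase_of_mem (Finset.mem_univ _), Finset.card_univ, Fintype.card_finset, Fintype.card_fin,
          nsmul_eq_mul]
        have h1 : 1 ≤ 2 ^ (d + 1) := Nat.one_le_two_pow
        push_cast [Nat.cast_sub h1]
        ring

/-- The lower side of the twin: `0 ≤ G^{Ω}(s,t) − B⁻¹_{T(2n)}(dblBox s, dblBox t)` (`c ≥ 0`, `m² > 0`; part Ν-a′). [cite: King1986, §4 p.670] -/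
theorem kingBoxGreen_sub_direct_nonneg {c m2 : ℝ} (hc : 0 ≤ c) (hm : 0 < m2) (s t : KingBox n) :
    0 ≤ kingBoxGreen n c m2 s t - (lapF (dblPer n) c m2)⁻¹ (dblBox n s) (dblBox n t) :=
  sub_nonneg.mpr (lapF_inv_dblBox_le_kingBoxGreen n hc hm s t)

end SupDistance

end Summit.QuantumFields.YangMills.BalabanUVNodes.N15KingModelRung.TorusSpectral
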